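import Summits.HodgeConjecture.HodgeConjecture.Theorems.R90S6TwistedConstantTermValue   -- ★ TB2a FILE 2b (p06): (V4) `exists_lintegral_descEpsConj_indicator_doubleCoset_eq_mul_tsum` (brings ★ 1c, ★ TJ1, ★ 1a, ★ FILE 2a)
import Summits.HodgeConjecture.HodgeConjecture.Theorems.R90S6TwistedNormFibreSum         -- ★ TB2d FILE B (p04): (B.2) `tsum_card_cells_normFibreParam_eq`, (B.4) (brings ★ TB3)
import HarnessLib

/-!
# R90 · S6 «Ch. 14.1–14.5 stable trace formula» — card TB2d, FILE C: THE ε-TWISTED ORBITAL INTEGRAL OF `𝟙_{K̃ϖ^λK̃}` AT AN ε-SPLIT `δ` —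
# SELECTION RULE AND NORM-FIBRE VALUE (`Theorems/R90S6TwistedHyperbolicHeckeFLValue.lean`)

Cell `hodgecm-mathlib`, crux H413 (`stmt-HodgeConjecture-24833`), route of record `HCCMUnconditional`; programme R90-TF (brief `director/R90-BRIEF.v2.md`
1f40d54518340a35), section S6 (base `R90-C14`, dealer R90-C14-plan (g2)), seat R90-C14-p04 (g2); CARD TB2d (dealt 2026-09-05T02:41:15Z): FILE A = ★ p864814
`R90S6TwistedHyperbolicHeckeFL` (the clause from value binders), FILE B = ★ p864931 `R90S6TwistedNormFibreSum` (the coefficient seam), FILE C = this file («seam §4 ∕ FILE C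
after p06 2b ★», dealer 03:03:11Z; ★ p864957 TB2a FILE 2b landed 03:15:15Z).  Lane `--kind proof --supports stmt-HodgeConjecture-24833 --as helper`; THEOREMS ONLY over
★ carriers (no definition, no instance, no notation, no named fact, no kit, no `sorry`); imports = ★ TB2a FILE 2b + ★ TB2d FILE B + HarnessLib.

## THE PRINT
[Rogawski1990, §4.10 (4.10.1)–(4.10.2), Prop. 4.10.1 (a) p. 58; Prop. 4.10.2 proof pp. 58–59; §4.11 p. 60]: at an ε-split `δ = diag(d)` (norm `Nδ = diag(d₀∕σd₂, d₁∕σd₁,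
d₂∕σd₀)` hyperbolic `G`-regular) the ε-twisted orbital integral of a Hecke shell `𝟙_{K̃ϖ^λK̃}` unfolds (Iwasawa `G̃ = Ñ Ã K̃`, ★ 1c) into the ε-twisted unipotent Jacobian
`J(δ) = |D(Nδ)|`-type factor (★ TJ1) times the constant terms of the shell along the ε-norm fibre through `e(δ)` (★ TB2a FILE 2b (V4):
`c · J(δ) · (κ(K̃) μ_N(Ñ₀) μAT(U₀)) · Σ'_{(n,m) ∈ ℤ²} #{γ ∈ K̃ϖ^λK̃∕K̃ : e(γ) = e(δ) + (n, 2m, n)}`).  ★ TB2d FILE B rewrites the `ℤ²`-sum: it is `0` unless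
`Σλ ≡ Σ e(δ) (mod 2)` — the SELECTION RULE of (4.10.1) («exactly one ε-class in the stable ε-class carries the shell», cf. ★ L2-sgn) — and otherwise the finite
NORM-FIBRE count `N_k(λ) = Σ_{μ ∈ e(cells), μ₀ − μ₂ = k} #{γ : e(γ) = μ}`, `k = e(δ)₀ − e(δ)₂`, which ★ (B.4) identifies with `u^{2k} · (𝒮_w(b c_λ))_{ℓ_k}` — the `U(3)`-side
Satake coefficient of the base-change partner `b c_λ` on the norm line, i.e. the number ★ B2a FILE 2 produces for `Φ(Nδ, b c_λ)`.

## WHAT IS PROVED (namespace `Summit.HodgeConjecture.HodgeConjecture.R90.S6`; frame = ★ (V4)'s VERBATIM)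
* (C.1) `exists_lintegral_descEpsConj_indicator_zpowDiagGL_eq_mul_ite_sum_normFibre` — **(V4) ∘ (B.2)**: one `c ∈ (0, ∞)` such that for every `λ`,
  `∫⁻ 𝟙_{K̃ϖ^λK̃}(y δ ε(y)⁻¹) dμGT = c · J(δ) · (κ(K̃) μ_N(Ñ₀) μAT(U₀)) · (if 2 ∣ Σλ − Σe(δ) then Σ_{μ ∈ e(cells), μ₀ − μ₂ = e(δ)₀ − e(δ)₂} #{γ : e γ = μ} else 0)`.
* (C.2) `exists_forall_lintegral_descEpsConj_indicator_zpowDiagGL_eq_zero_of_not_even` — **THE SELECTION RULE FOR THE INTEGRAL**: if `Σλ ≢ Σe(δ) (mod 2)`, the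
  ε-twisted orbital integral of `𝟙_{K̃ϖ^λK̃}` at `δ` (against `μGT`) is `0`.
* (C.3) `exists_lintegral_descEpsConj_indicator_zpowDiagGL_eq_mul_natCast_sum_normFibre` — in the parity case the value is `c · J(δ) · masses · (N_k(λ) : ℝ≥0∞)` with
  the count `N_k(λ) ∈ ℕ` cast ONCE (so that ★ (B.4) `cast_sum_normFibre_card_cells_eq_mul_coeff_satakeTransform_bcGraphPartner` — `(N_k(λ) : ℂ) = u^{2k} ·
  (𝒮_w(b c_λ))_{ℓ_k}` — reads it by name): the `hTO = J · S` binder of ★ FILE A (A.2) with `S = c · masses · N_k(λ)`, `J = J(δ)` = ★ B2a's `(‖a−1‖·√‖b−1‖)⁻¹` at `Nδ`.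

HONEST LABEL: HC_CM is proved only modulo the 7 printed citations (2 remaining named inputs: hLiu418 = `stmt-HodgeConjecture-24832`, h413 =
`stmt-HodgeConjecture-24833`) until rung 0 closes; REL ≠ ★ ≠ BUILT.  The measure constant `c` and the mass `μAT(U₀)` stay UNPINNED (★ FILE 2b's honest gap (i)); the
`ℝ≥0∞ → ℂ` reading of the left side in ★ `Ch4Sec10.epsOrbitalIntegral` (Bochner) currency and the carrier junction `K = L_w` with ★ B2a are the assembling seat's
(not in this file).  This file discharges no named input.

## References
* [Rogawski1990] J. D. Rogawski, *Automorphic Representations of Unitary Groups in Three Variables*, Ann. of Math. Stud. 123 (1990), §4.10 (4.10.1)–(4.10.2),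
  Prop. 4.10.1 (a), Prop. 4.10.2 pp. 57–59, §4.11 p. 60.
* [Kottwitz1986BaseChangeUnits] R. Kottwitz, *Base change for unit elements of Hecke algebras*, Compositio Math. 60 (1986), §1 pp. 239–240, §3.
* [CartierCorvallis1979] P. Cartier, *Representations of 𝔭-adic groups: a survey*, PSPM 33.1 (1979), §IV (4.2) p. 146.
-/

set_option autoImplicit false
-- the mandated namespace repeats the single-problem summit's segment (`HodgeConjecture.HodgeConjecture`)
set_option linter.dupNamespace false

noncomputable section

open MeasureTheory Measure Set Function Filter Topology
open scoped ENNReal NNReal Pointwise MatrixGroups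
open ValuativeRel MulAction Finset
open Literature.NumberTheory.Automorphic Literature.MeasureTheory.Group Literature.NumberTheory.Rogawski1990.Ch4Sec10
open Literature.NumberTheory.GaloisRepresentations Literature.NumberTheory.GaloisRepresentations.IsNonarchimedeanLocalField
open Literature.NumberTheory.Automorphic.heckeAlgebra

namespace Summit.HodgeConjecture.HodgeConjecture.R90.S6

section Value

-- the frame of ★ TB2a FILE 2b (V4), VERBATIM
variable {K : Type*} [Field K] [ValuativeRel K] [TopologicalSpace K] [IsNonarchimedeanLocalField K] [MeasurableSpace K] [BorelSpace K]
  [IsDiscreteValuationRing 𝒪[K]] {ϖ : K} (hϖ : IsUniformizingElement ϖ)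
  [MeasurableSpace (GL (Fin 3) K)] [BorelSpace (GL (Fin 3) K)]
  (σ : K →+* K) (hσ : ∀ x, σ (σ x) = x) (hσc : Continuous σ)
  (ε : GL (Fin 3) K →* GL (Fin 3) K) (hε : Continuous ε) (hεΘ : ∀ g, ε g = UnitaryGroup.qsInvolution σ g)
  (hεK : ∀ k ∈ glInt 3 K, ε k ∈ glInt 3 K)
  (δ : GL (Fin 3) K) (d : Fin 3 → K) (hδ : (δ : Matrix (Fin 3) (Fin 3) K) = Matrix.diagonal d)

include hϖ hσ hσc hε hεΘ hεK hδ in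
/-- **(C.1) THE ε-TWISTED ORBITAL INTEGRAL OF `𝟙_{K̃ϖ^λK̃}` AT AN ε-SPLIT `δ`: SELECTION RULE AND NORM-FIBRE COUNT.**  In ★ (V4)'s frame VERBATIM: there is ONE
`c ∈ (0, ∞)` such that for every `λ : Fin 3 → ℤ`, with `e = iwasawaExp hϖ`, `O_λ` = the `K̃`-cells of `K̃ϖ^λK̃`, `J(δ)` = ★ TJ1's constant and the masses `κ(K̃) · μ_N(Ñ₀) ·
μAT(U₀)`: `∫⁻ 𝟙_{K̃ϖ^λK̃}(y δ ε(y)⁻¹) dμGT(y) = c · J(δ) · masses · (if 2 ∣ Σλ − Σ e(δ) then Σ_{μ ∈ e(O_λ), μ₀ − μ₂ = e(δ)₀ − e(δ)₂} #{γ ∈ O_λ : e γ = μ} else 0)` —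
★ (V4) `exists_lintegral_descEpsConj_indicator_doubleCoset_eq_mul_tsum` at `g = ϖ^λ` ∘ ★ (B.2) `tsum_card_cells_normFibreParam_eq` (anchor `c = e(δ)`, `α = ℝ≥0∞`).
[cite: Rogawski1990, §4.10 (4.10.1) p. 57, Prop. 4.10.2 proof pp. 58–59] [cite: Kottwitz1986BaseChangeUnits, §1 pp. 239–240] [cite: CartierCorvallis1979, §IV (4.2) p. 146] -/
theorem exists_lintegral_descEpsConj_indicator_zpowDiagGL_eq_mul_ite_sum_normFibre (hσ1 : ∃ x, σ x ≠ x)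
    [IsHeckeTriple (⊤ : Submonoid (GL (Fin 3) K)) (glInt 3 K) (glInt 3 K)]
    (ha : d 2 / d 1 * σ (d 1 / d 0) - 1 ≠ 0) (hb : 1 - d 2 / d 0 * σ (d 2 / d 0) ≠ 0)
    {A : Subgroup (GL (Fin 3) K)} (hAid : A = standardLeviGL K (_root_.id : Fin 3 → Fin 3))
    (hT : IsClosed (epsCentralizer ε δ : Set (GL (Fin 3) K))) (hTA : epsCentralizer ε δ ≤ A)
    [MeasurableSpace (GL (Fin 3) K ⧸ epsCentralizer ε δ)] [BorelSpace (GL (Fin 3) K ⧸ epsCentralizer ε δ)]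
    [MeasurableSpace (GL (Fin 3) K ⧸ A)] [BorelSpace (GL (Fin 3) K ⧸ A)]
    [MeasurableSpace (↥A ⧸ (epsCentralizer ε δ).subgroupOf A)] [BorelSpace (↥A ⧸ (epsCentralizer ε δ).subgroupOf A)]
    (μGT : Measure (GL (Fin 3) K ⧸ epsCentralizer ε δ)) [SMulInvariantMeasure (GL (Fin 3) K) (GL (Fin 3) K ⧸ epsCentralizer ε δ) μGT]
    [IsFiniteMeasureOnCompacts μGT] (hGT : μGT ≠ 0)
    (μGA : Measure (GL (Fin 3) K ⧸ A)) [SMulInvariantMeasure (GL (Fin 3) K) (GL (Fin 3) K ⧸ A) μGA] [IsFiniteMeasureOnCompacts μGA] (hGA : μGA ≠ 0)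
    (μAT : Measure (↥A ⧸ (epsCentralizer ε δ).subgroupOf A)) [SMulInvariantMeasure ↥A (↥A ⧸ (epsCentralizer ε δ).subgroupOf A) μAT]
    [IsFiniteMeasureOnCompacts μAT] (hAT : μAT ≠ 0)
    (κ : Measure ↥(glInt 3 K)) [IsHaarMeasure κ] (μN : Measure ↥(upperUnitriangular (Fin 3) K)) [IsHaarMeasure μN] :
    ∃ c : ℝ≥0∞, c ≠ 0 ∧ c ≠ ∞ ∧ ∀ lam : Fin 3 → ℤ,
      ∫⁻ y, descEpsConj ε δ (epsCentralizer ε δ)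
          (((glInt 3 K : Set (GL (Fin 3) K)) * {zpowDiagGL hϖ.ne_zero lam} * (glInt 3 K : Set (GL (Fin 3) K))).indicator
            (1 : GL (Fin 3) K → ℝ≥0∞)) y ∂μGT =
        c * ((((normAbs K (d 2 / d 1 * σ (d 1 / d 0) - 1))⁻¹ * (NNReal.sqrt (normAbs K (1 - d 2 / d 0 * σ (d 2 / d 0))))⁻¹ : ℝ≥0)) : ℝ≥0∞) *
          (κ Set.univ * μN {u : ↥(upperUnitriangular (Fin 3) K) | (u : GL (Fin 3) K) ∈ glInt 3 K} *
            μAT {z | descEpsConj ε δ (epsCentralizer ε δ) (fun m => iwasawaExp hϖ m) (inclQuot (epsCentralizer ε δ) A z) = iwasawaExp hϖ δ}) *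
          (if 2 ∣ ∑ i, lam i - ∑ i, iwasawaExp hϖ δ i then
            ∑ μ ∈ ((finite_orbit_quotient (glInt 3 K) (zpowDiagGL hϖ.ne_zero lam)).toFinset.image fun γ => iwasawaExp hϖ γ.out) with
                μ 0 - μ 2 = iwasawaExp hϖ δ 0 - iwasawaExp hϖ δ 2,
              (((finite_orbit_quotient (glInt 3 K) (zpowDiagGL hϖ.ne_zero lam)).toFinset.filter fun γ => iwasawaExp hϖ γ.out = μ).card : ℝ≥0∞)
          else 0) := by
  obtain ⟨c, hc0, hc, h⟩ := exists_lintegral_descEpsConj_indicator_doubleCoset_eq_mul_tsum hϖ σ hσ hσc ε hε hεΘ hεK δ d hδ hσ1 ha hb hAid hT hTA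
    μGT hGT μGA hGA μAT hAT κ μN
  refine ⟨c, hc0, hc, fun lam => ?_⟩
  rw [h (zpowDiagGL hϖ.ne_zero lam), tsum_card_cells_normFibreParam_eq hϖ lam (iwasawaExp hϖ δ)]

include hϖ hσ hσc hε hεΘ hεK hδ in
/-- **(C.2) THE SELECTION RULE FOR THE TWISTED ORBITAL INTEGRAL**: if `Σλ ≢ Σ e(δ) (mod 2)` then `∫⁻ 𝟙_{K̃ϖ^λK̃}(y δ ε(y)⁻¹) dμGT(y) = 0` — the shell `K̃ϖ^λK̃` misses
the whole ε-orbit of `δ` (the wrong-parity ε-class of (4.10.1) carries nothing; ★ L2-sgn `twistedShell_eq_empty_of_not_even` is the set-level edition).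
[cite: Rogawski1990, §4.10 (4.10.1) p. 57; §3.11 p. 35] [cite: Kottwitz1986BaseChangeUnits, §3] -/
theorem exists_forall_lintegral_descEpsConj_indicator_zpowDiagGL_eq_zero_of_not_even (hσ1 : ∃ x, σ x ≠ x)
    [IsHeckeTriple (⊤ : Submonoid (GL (Fin 3) K)) (glInt 3 K) (glInt 3 K)]
    (ha : d 2 / d 1 * σ (d 1 / d 0) - 1 ≠ 0) (hb : 1 - d 2 / d 0 * σ (d 2 / d 0) ≠ 0)
    {A : Subgroup (GL (Fin 3) K)} (hAid : A = standardLeviGL K (_root_.id : Fin 3 → Fin 3))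
    (hT : IsClosed (epsCentralizer ε δ : Set (GL (Fin 3) K))) (hTA : epsCentralizer ε δ ≤ A)
    [MeasurableSpace (GL (Fin 3) K ⧸ epsCentralizer ε δ)] [BorelSpace (GL (Fin 3) K ⧸ epsCentralizer ε δ)]
    [MeasurableSpace (GL (Fin 3) K ⧸ A)] [BorelSpace (GL (Fin 3) K ⧸ A)]
    [MeasurableSpace (↥A ⧸ (epsCentralizer ε δ).subgroupOf A)] [BorelSpace (↥A ⧸ (epsCentralizer ε δ).subgroupOf A)]
    (μGT : Measure (GL (Fin 3) K ⧸ epsCentralizer ε δ)) [SMulInvariantMeasure (GL (Fin 3) K) (GL (Fin 3) K ⧸ epsCentralizer ε δ) μGT]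
    [IsFiniteMeasureOnCompacts μGT] (hGT : μGT ≠ 0)
    (μGA : Measure (GL (Fin 3) K ⧸ A)) [SMulInvariantMeasure (GL (Fin 3) K) (GL (Fin 3) K ⧸ A) μGA] [IsFiniteMeasureOnCompacts μGA] (hGA : μGA ≠ 0)
    (μAT : Measure (↥A ⧸ (epsCentralizer ε δ).subgroupOf A)) [SMulInvariantMeasure ↥A (↥A ⧸ (epsCentralizer ε δ).subgroupOf A) μAT]
    [IsFiniteMeasureOnCompacts μAT] (hAT : μAT ≠ 0)
    (κ : Measure ↥(glInt 3 K)) [IsHaarMeasure κ] (μN : Measure ↥(upperUnitriangular (Fin 3) K)) [IsHaarMeasure μN]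
    {lam : Fin 3 → ℤ} (hpar : ¬ 2 ∣ ∑ i, lam i - ∑ i, iwasawaExp hϖ δ i) :
    ∫⁻ y, descEpsConj ε δ (epsCentralizer ε δ)
        (((glInt 3 K : Set (GL (Fin 3) K)) * {zpowDiagGL hϖ.ne_zero lam} * (glInt 3 K : Set (GL (Fin 3) K))).indicator
          (1 : GL (Fin 3) K → ℝ≥0∞)) y ∂μGT = 0 := by
  obtain ⟨c, -, -, h⟩ := exists_lintegral_descEpsConj_indicator_zpowDiagGL_eq_mul_ite_sum_normFibre hϖ σ hσ hσc ε hε hεΘ hεK δ d hδ hσ1 ha hb hAid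
    hT hTA μGT hGT μGA hGA μAT hAT κ μN
  rw [h lam, if_neg hpar, mul_zero]

include hϖ hσ hσc hε hεΘ hεK hδ in
/-- **(C.3) THE VALUE IN THE PARITY CASE, COUNT CAST ONCE**: one `c ∈ (0, ∞)` such that for every `λ` with `Σλ ≡ Σ e(δ) (mod 2)`:
`∫⁻ 𝟙_{K̃ϖ^λK̃}(y δ ε(y)⁻¹) dμGT(y) = c · J(δ) · masses · (N_k(λ) : ℝ≥0∞)`, `N_k(λ) = Σ_{μ ∈ e(O_λ), μ₀ − μ₂ = k} #{γ ∈ O_λ : e γ = μ} ∈ ℕ`, `k = e(δ)₀ − e(δ)₂` — and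
★ (B.4) reads `(N_k(λ) : ℂ) = u^{2k} · (𝒮_w(b c_λ))_{ℓ_k}` by name: the `λ`-dependence of the twisted side of (4.10.2) is the base-change partner's Satake coefficient on
the norm line (the `hTO = J · S` binder of ★ FILE A (A.2) with `S = c · masses · N_k(λ)`). [cite: Rogawski1990, §4.10 Prop. 4.10.1 (a), Prop. 4.10.2 pp. 58–59]
[cite: CartierCorvallis1979, §IV (4.2) p. 146] -/
theorem exists_lintegral_descEpsConj_indicator_zpowDiagGL_eq_mul_natCast_sum_normFibre (hσ1 : ∃ x, σ x ≠ x)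
    [IsHeckeTriple (⊤ : Submonoid (GL (Fin 3) K)) (glInt 3 K) (glInt 3 K)]
    (ha : d 2 / d 1 * σ (d 1 / d 0) - 1 ≠ 0) (hb : 1 - d 2 / d 0 * σ (d 2 / d 0) ≠ 0)
    {A : Subgroup (GL (Fin 3) K)} (hAid : A = standardLeviGL K (_root_.id : Fin 3 → Fin 3))
    (hT : IsClosed (epsCentralizer ε δ : Set (GL (Fin 3) K))) (hTA : epsCentralizer ε δ ≤ A)
    [MeasurableSpace (GL (Fin 3) K ⧸ epsCentralizer ε δ)] [BorelSpace (GL (Fin 3) K ⧸ epsCentralizer ε δ)]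
    [MeasurableSpace (GL (Fin 3) K ⧸ A)] [BorelSpace (GL (Fin 3) K ⧸ A)]
    [MeasurableSpace (↥A ⧸ (epsCentralizer ε δ).subgroupOf A)] [BorelSpace (↥A ⧸ (epsCentralizer ε δ).subgroupOf A)]
    (μGT : Measure (GL (Fin 3) K ⧸ epsCentralizer ε δ)) [SMulInvariantMeasure (GL (Fin 3) K) (GL (Fin 3) K ⧸ epsCentralizer ε δ) μGT]
    [IsFiniteMeasureOnCompacts μGT] (hGT : μGT ≠ 0)
    (μGA : Measure (GL (Fin 3) K ⧸ A)) [SMulInvariantMeasure (GL (Fin 3) K) (GL (Fin 3) K ⧸ A) μGA] [IsFiniteMeasureOnCompacts μGA] (hGA : μGA ≠ 0)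
    (μAT : Measure (↥A ⧸ (epsCentralizer ε δ).subgroupOf A)) [SMulInvariantMeasure ↥A (↥A ⧸ (epsCentralizer ε δ).subgroupOf A) μAT]
    [IsFiniteMeasureOnCompacts μAT] (hAT : μAT ≠ 0)
    (κ : Measure ↥(glInt 3 K)) [IsHaarMeasure κ] (μN : Measure ↥(upperUnitriangular (Fin 3) K)) [IsHaarMeasure μN] :
    ∃ c : ℝ≥0∞, c ≠ 0 ∧ c ≠ ∞ ∧ ∀ lam : Fin 3 → ℤ, 2 ∣ ∑ i, lam i - ∑ i, iwasawaExp hϖ δ i →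
      ∫⁻ y, descEpsConj ε δ (epsCentralizer ε δ)
          (((glInt 3 K : Set (GL (Fin 3) K)) * {zpowDiagGL hϖ.ne_zero lam} * (glInt 3 K : Set (GL (Fin 3) K))).indicator
            (1 : GL (Fin 3) K → ℝ≥0∞)) y ∂μGT =
        c * ((((normAbs K (d 2 / d 1 * σ (d 1 / d 0) - 1))⁻¹ * (NNReal.sqrt (normAbs K (1 - d 2 / d 0 * σ (d 2 / d 0))))⁻¹ : ℝ≥0)) : ℝ≥0∞) *
          (κ Set.univ * μN {u : ↥(upperUnitriangular (Fin 3) K) | (u : GL (Fin 3) K) ∈ glInt 3 K} *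
            μAT {z | descEpsConj ε δ (epsCentralizer ε δ) (fun m => iwasawaExp hϖ m) (inclQuot (epsCentralizer ε δ) A z) = iwasawaExp hϖ δ}) *
          ((∑ μ ∈ ((finite_orbit_quotient (glInt 3 K) (zpowDiagGL hϖ.ne_zero lam)).toFinset.image fun γ => iwasawaExp hϖ γ.out) with
                μ 0 - μ 2 = iwasawaExp hϖ δ 0 - iwasawaExp hϖ δ 2,
              ((finite_orbit_quotient (glInt 3 K) (zpowDiagGL hϖ.ne_zero lam)).toFinset.filter fun γ => iwasawaExp hϖ γ.out = μ).card : ℕ) : ℝ≥0∞) := by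
  obtain ⟨c, hc0, hc, h⟩ := exists_lintegral_descEpsConj_indicator_zpowDiagGL_eq_mul_ite_sum_normFibre hϖ σ hσ hσc ε hε hεΘ hεK δ d hδ hσ1 ha hb hAid
    hT hTA μGT hGT μGA hGA μAT hAT κ μN
  refine ⟨c, hc0, hc, fun lam hpar => ?_⟩
  rw [h lam, if_pos hpar, Nat.cast_sum]

end Value

end Summit.HodgeConjecture.HodgeConjecture.R90.S6
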